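import Mathlib.Analysis.Analytic.Linear
import Mathlib.Analysis.Analytic.Uniqueness
import Mathlib.Analysis.Analytic.ChangeOrigin
import Mathlib.Analysis.Normed.Module.Convex
import Mathlib.Analysis.InnerProductSpace.PiL2
import Literature.Analysis.Calculus.RealAnalyticPlanarZeroSetBranches
import Literature.ModelTheory.ExponentialFields.OMinimalPlanarConicStructure
import Literature.ModelTheory.ExponentialFields.RestrictedAnalyticDefinable
import Literature.ModelTheory.ExponentialFields.RealAnExp
import HarnessLib

/-!
# The planar real-analytic conic structure follows from the o-minimality of `ℝ_an(,exp)`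

Proof file (theorems only).  The named fact
`Literature.Analysis.Calculus.realAnalytic_planarZeroSet_conicStructure`
(`RealAnalyticPlanarZeroSetBranches.lean`: van den Dries 1998, Ch. 9 (2.3), local conic structure,
for the zero set of a planar real-analytic function) is DERIVED here from the o-minimality of any
expansion `L` of the real field in which the restricted analytic functions are definable
(`IsRealFieldExpansion L`, `∀ n f, DefinableFun L f.restrict`, `L.IsOMinimal ℝ` — the hypothesis
shape of the tree's `buchner1977_cutLocus_triangulable_of_isOMinimal_expansion`), in particular
from the tree's named fact `VandendriesMiller1994_realAnExp_isOMinimal` (`ℝ_an,exp` is o-minimal;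
the smaller input "`ℝ_an` is o-minimal", Gabrielov 1968 / Denef–van den Dries 1988, suffices as soon
as it is available in the tree in the form `Language.realAn.IsOMinimal ℝ`).

Road (as announced in the docstring of the fact): `g` analytic near `q` ⇒ the zero set of `g`
inside a compact union of closed boxes `D` around `q` is `L`-definable
(`IsRealFieldExpansion.exists_boxes_definable_graphOn`, `definable_setOf_mem_and_nonneg` of
`RestrictedAnalyticDefinable.lean`); it has empty interior by the identity principle
(`AnalyticOnNhd.eqOn_zero_of_preconnected_of_eventuallyEq_zero`), hence o-minimal dimension `≤ 1`
(`interior_nonempty_of_dim_eq`); the planar conic structure of one-dimensional definable sets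
(`PlanarConic.exists_branches_of_dim_le_one`, `OMinimalPlanarConicStructure.lean`) gives finitely
many continuous branches parametrised by the squared distance `t`; reparametrising by `t = (ε s)²`
and transporting along `EuclideanSpace.equiv` yields the half-branches of the fact.

* `realAnalytic_planarZeroSet_conicStructure_of_isOMinimal_expansion` — from `(L, hL, hAn, hO)`;
* `realAnalytic_planarZeroSet_conicStructure_of_realAnExp_isOMinimal` — from the named fact
  `VandendriesMiller1994_realAnExp_isOMinimal`.

## References

* [Dries1998] L. van den Dries, *Tame topology and o-minimal structures* (1998), Ch. 9 (2.3)
  pp. 149–150; Introduction p. 3.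
* [VandendriesMiller1994] L. van den Dries, C. Miller, Israel J. Math. 85 (1994), Introduction.
* [vandenDries1986] L. van den Dries, Bull. AMS 15 (1986), Theorem p. 191.
-/

noncomputable section

open Set Filter FirstOrder FirstOrder.Language
open _root_.Topology
open Literature.ModelTheory.ExponentialFields Literature.ModelTheory.ExponentialFields.CellDimension

namespace Literature.Analysis.Calculus

universe u v

/-- Squared Euclidean distance in `ℝ²` in coordinates: for `x : Fin 2 → ℝ` and
`q : EuclideanSpace ℝ (Fin 2)`, `dist (toLp x) q = √((x₀ − q₀)² + (x₁ − q₁)²)`. [folklore] -/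
private theorem dist_toLp_eq (x : Fin 2 → ℝ) (q : EuclideanSpace ℝ (Fin 2)) :
    dist ((EuclideanSpace.equiv (Fin 2) ℝ).symm x) q =
      Real.sqrt ((x 0 - q 0) ^ 2 + (x 1 - q 1) ^ 2) := by
  rw [EuclideanSpace.dist_eq, Fin.sum_univ_two]
  congr 1
  simp [Real.dist_eq, sq_abs]

/-- **From curves parametrised by the squared distance to the half-branches of the fact**
(the elementary tail of the reduction): given finitely many continuous curves `γ_i` on `(0, b)` in
coordinates `ℝ^{Fin 2}` with `‖γ_i(t) − q‖² = t`, lying in a set `E` on which `g` vanishes and which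
contains every zero of `g` within distance `r₁` of `q`, pairwise disjoint and covering
`E ∩ {0 < ‖· − q‖² < b}`, the reparametrisation `β_i(s) := γ_i((ε s)²)` (`β_i(0) := q`) with
`ε = min(r₁, √b / 2)` has all the properties required by `realAnalytic_planarZeroSet_conicStructure`
for `g` at `q`. [cite: Dries1998, Ch. 9 (2.3) pp. 149–150] -/
theorem conic_of_curves (g : EuclideanSpace ℝ (Fin 2) → ℝ) (q : EuclideanSpace ℝ (Fin 2))
    (hgq : g q = 0) {r₁ b : ℝ} (hr₁ : 0 < r₁) (hb : 0 < b) (E : Set (Fin 2 → ℝ))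
    (hEg : ∀ x' ∈ E, g ((EuclideanSpace.equiv (Fin 2) ℝ).symm x') = 0)
    (hgE : ∀ x, g x = 0 → dist x q ≤ r₁ → (EuclideanSpace.equiv (Fin 2) ℝ) x ∈ E)
    {m : ℕ} (γ : Fin m → ℝ → (Fin 2 → ℝ)) (hγc : ∀ i, ContinuousOn (γ i) (Ioo 0 b))
    (hγE : ∀ i, ∀ t ∈ Ioo (0 : ℝ) b, γ i t ∈ E ∧
      (γ i t 0 - (EuclideanSpace.equiv (Fin 2) ℝ) q 0) ^ 2 +
        (γ i t 1 - (EuclideanSpace.equiv (Fin 2) ℝ) q 1) ^ 2 = t)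
    (hγinj : ∀ i j, ∀ t ∈ Ioo (0 : ℝ) b, γ i t = γ j t → i = j)
    (hγcov : ∀ x ∈ E, 0 < (x 0 - (EuclideanSpace.equiv (Fin 2) ℝ) q 0) ^ 2 +
        (x 1 - (EuclideanSpace.equiv (Fin 2) ℝ) q 1) ^ 2 →
      (x 0 - (EuclideanSpace.equiv (Fin 2) ℝ) q 0) ^ 2 +
        (x 1 - (EuclideanSpace.equiv (Fin 2) ℝ) q 1) ^ 2 < b →
      ∃ i, x = γ i ((x 0 - (EuclideanSpace.equiv (Fin 2) ℝ) q 0) ^ 2 +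
        (x 1 - (EuclideanSpace.equiv (Fin 2) ℝ) q 1) ^ 2)) :
    ∃ ε : ℝ, 0 < ε ∧ ∃ (m : ℕ) (β : Fin m → ℝ → EuclideanSpace ℝ (Fin 2)),
      (∀ i, ContinuousOn (β i) (Set.Icc 0 1) ∧ β i 0 = q ∧
        ∀ s ∈ Set.Icc (0 : ℝ) 1, g (β i s) = 0 ∧ dist (β i s) q = ε * s) ∧
      (∀ i j, ∀ s ∈ Set.Ioc (0 : ℝ) 1, β i s = β j s → i = j) ∧
      (∀ x : EuclideanSpace ℝ (Fin 2), g x = 0 → 0 < dist x q → dist x q ≤ ε →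
        ∃ i, ∃ s ∈ Set.Ioc (0 : ℝ) 1, x = β i s) := by
  classical
  set T := EuclideanSpace.equiv (Fin 2) ℝ with hT
  set q' : Fin 2 → ℝ := T q with hq'
  have hq'i : ∀ i, q' i = q i := fun i => rfl
  -- the radius `ε`: `ε ≤ r₁` and `ε² < b`
  set ε : ℝ := min r₁ (Real.sqrt b / 2) with hε
  have hε0 : 0 < ε := lt_min hr₁ (by positivity)
  have hεr : ε ≤ r₁ := min_le_left _ _
  have hεb : ε ^ 2 < b := by
    have h1 : ε ≤ Real.sqrt b / 2 := min_le_right _ _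
    have h2 : (Real.sqrt b / 2) ^ 2 = b / 4 := by
      rw [div_pow, Real.sq_sqrt hb.le]; norm_num
    have h3 : ε ^ 2 ≤ (Real.sqrt b / 2) ^ 2 := pow_le_pow_left₀ hε0.le h1 2
    linarith
  have ht : ∀ s : ℝ, 0 < s → s ≤ 1 → (ε * s) ^ 2 ∈ Ioo (0 : ℝ) b := by
    intro s hs hs1
    refine ⟨by positivity, ?_⟩
    have : (ε * s) ^ 2 ≤ ε ^ 2 := by
      rw [mul_pow]
      nlinarith [pow_le_one₀ hs.le hs1 (n := 2), sq_nonneg ε]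
    exact this.trans_lt hεb
  -- the half-branches
  set β : Fin m → ℝ → EuclideanSpace ℝ (Fin 2) := fun i s =>
    if 0 < s then T.symm (γ i ((ε * s) ^ 2)) else q with hβ
  have hβpos : ∀ i s, 0 < s → β i s = T.symm (γ i ((ε * s) ^ 2)) := fun i s hs => by
    simp [hβ, hs]
  have hβdist : ∀ i s, 0 < s → s ≤ 1 → dist (β i s) q = ε * s := by
    intro i s hs hs1
    rw [hβpos i s hs, dist_toLp_eq]
    have h := (hγE i _ (ht s hs hs1)).2
    simp only [hq'i] at h
    rw [show (γ i ((ε * s) ^ 2) 0 - q 0) ^ 2 + (γ i ((ε * s) ^ 2) 1 - q 1) ^ 2 = (ε * s) ^ 2 from h,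
      Real.sqrt_sq (by positivity)]
  refine ⟨ε, hε0, m, β, fun i => ⟨?_, by simp [hβ], fun s hs => ?_⟩, ?_, ?_⟩
  · -- continuity on `[0, 1]`
    intro s hs
    by_cases hs0 : 0 < s
    · have hcont : ContinuousAt (fun s : ℝ => T.symm (γ i ((ε * s) ^ 2))) s := by
        have h1 : ContinuousAt (fun s : ℝ => (ε * s) ^ 2) s :=
          ((continuous_const.mul continuous_id).pow 2).continuousAt
        have h2 : ContinuousAt (γ i) ((ε * s) ^ 2) :=
          (hγc i).continuousAt (Ioo_mem_nhds (ht s hs0 hs.2).1 (ht s hs0 hs.2).2)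
        have h3 : ContinuousAt (fun s : ℝ => γ i ((ε * s) ^ 2)) s :=
          ContinuousAt.comp (f := fun s : ℝ => (ε * s) ^ 2) (g := γ i) h2 h1
        exact ContinuousAt.comp (f := fun s : ℝ => γ i ((ε * s) ^ 2)) (g := fun y => T.symm y)
          T.symm.continuous.continuousAt h3
      refine (hcont.congr ?_).continuousWithinAt
      filter_upwards [lt_mem_nhds hs0] with s' hs'
      exact (hβpos i s' hs').symm
    · have hs00 : s = 0 := le_antisymm (not_lt.1 hs0) hs.1
      subst hs00
      rw [ContinuousWithinAt, show β i 0 = q by simp [hβ], Metric.tendsto_nhds]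
      intro δ hδ
      have hev : ∀ᶠ s' in 𝓝[Icc (0 : ℝ) 1] (0 : ℝ), s' ∈ Icc (0 : ℝ) 1 ∧ s' < δ / ε := by
        refine Filter.inter_mem self_mem_nhdsWithin ?_
        exact mem_nhdsWithin_of_mem_nhds (gt_mem_nhds (by positivity))
      filter_upwards [hev] with s' hs'
      obtain ⟨⟨h0, h1⟩, hlt'⟩ := hs'
      rcases h0.eq_or_lt with h00 | hpos
      · rw [← h00]; simp [hβ, hδ]
      · rw [hβdist i s' hpos h1]
        calc ε * s' < ε * (δ / ε) := mul_lt_mul_of_pos_left hlt' hε0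
          _ = δ := mul_div_cancel₀ δ hε0.ne'
  · -- on the zero set, at distance `ε s`
    rcases hs.1.eq_or_lt with h00 | hpos
    · rw [← h00]; simp [hβ, hgq]
    · refine ⟨?_, hβdist i s hpos hs.2⟩
      rw [hβpos i s hpos]
      exact hEg _ (hγE i _ (ht s hpos hs.2)).1
  · -- disjointness on `(0, 1]`
    intro i j s hs hij
    rw [hβpos i s hs.1, hβpos j s hs.1] at hij
    exact hγinj i j _ (ht s hs.1 hs.2) (T.symm.injective hij)
  · -- covering of the closed punctured disc
    intro x hgx hpos hle
    set x' : Fin 2 → ℝ := T x with hx'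
    have hTx' : T.symm x' = x := T.symm_apply_apply x
    have hx'E : x' ∈ E := hgE x hgx (hle.trans hεr)
    have hρ : (x' 0 - q' 0) ^ 2 + (x' 1 - q' 1) ^ 2 = dist x q ^ 2 := by
      have h := dist_toLp_eq x' q
      rw [hTx'] at h
      rw [h, Real.sq_sqrt (by positivity)]
      rfl
    have hρ0 : 0 < (x' 0 - q' 0) ^ 2 + (x' 1 - q' 1) ^ 2 := by rw [hρ]; positivity
    have hρb : (x' 0 - q' 0) ^ 2 + (x' 1 - q' 1) ^ 2 < b := by
      rw [hρ]
      calc dist x q ^ 2 ≤ ε ^ 2 := pow_le_pow_left₀ dist_nonneg hle 2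
        _ < b := hεb
    obtain ⟨i, hi⟩ := hγcov x' hx'E hρ0 hρb
    refine ⟨i, dist x q / ε, ⟨by positivity, (div_le_one hε0).2 hle⟩, ?_⟩
    rw [hβpos i _ (by positivity), show (ε * (dist x q / ε)) ^ 2 = dist x q ^ 2 by
      rw [mul_div_cancel₀ _ hε0.ne'], ← hρ, ← hi, hTx']

/-- **The planar real-analytic conic structure from an o-minimal expansion of the real field
defining the restricted analytic functions.**  For a first-order language `L` on `ℝ` expanding
the real field (`IsRealFieldExpansion L`), in which every restricted analytic function is a
definable function, and which is o-minimal, the named fact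
`realAnalytic_planarZeroSet_conicStructure` holds.  Instances: `L = ℝ_an` (Gabrielov 1968 /
Denef–van den Dries 1988) and `L = ℝ_an,exp` (van den Dries–Miller 1994, the tree's named fact —
next theorem). [cite: Dries1998, Ch. 9 (2.3) pp. 149–150] -/
theorem realAnalytic_planarZeroSet_conicStructure_of_isOMinimal_expansion
    (L : Language.{u, v}) [L.Structure ℝ] (hL : IsRealFieldExpansion L)
    (hAn : ∀ (n : ℕ) (f : RestrictedAnalytic n), (univ : Set ℝ).DefinableFun L f.restrict)
    (hO : L.IsOMinimal ℝ) : realAnalytic_planarZeroSet_conicStructure := by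
  classical
  intro g q hg hgq hfreq
  have hlt := hL.definable_lt
  set T := EuclideanSpace.equiv (Fin 2) ℝ with hT
  -- `g` is analytic on a ball `B(q, r₀)`
  obtain ⟨r₀, hr₀, hball⟩ : ∃ r₀ > 0, ∀ y ∈ Metric.ball q r₀, AnalyticAt ℝ g y :=
    Metric.eventually_nhds_iff_ball.1 hg.eventually_analyticAt
  have hgball : AnalyticOnNhd ℝ g (Metric.ball q r₀) := fun y hy => hball y hy
  -- transported function and sets in `Fin 2 → ℝ`
  set g' : (Fin 2 → ℝ) → ℝ := fun x => g (T.symm x) with hg'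
  set U : Set (Fin 2 → ℝ) := T.symm ⁻¹' Metric.ball q r₀ with hU
  have hUo : IsOpen U := Metric.isOpen_ball.preimage T.symm.continuous
  have hg'U : AnalyticOnNhd ℝ g' U := fun x hx =>
    (hball _ hx).comp ((T.symm : (Fin 2 → ℝ) →L[ℝ] EuclideanSpace ℝ (Fin 2)).analyticAt x)
  set C : Set (Fin 2 → ℝ) := T '' Metric.closedBall q (r₀ / 2) with hC
  have hCc : IsCompact C := (isCompact_closedBall q _).image T.continuous
  have hCU : C ⊆ U := by
    rintro _ ⟨y, hy, rfl⟩
    show T.symm (T y) ∈ Metric.ball q r₀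
    rw [T.symm_apply_apply]
    exact Metric.closedBall_subset_ball (by linarith) hy
  obtain ⟨D, hCD, hDU, -, hDdef, hgraph⟩ := hL.exists_boxes_definable_graphOn hAn hUo hCc hCU
  -- the zero set of `g'` in `D` is definable
  set E : Set (Fin 2 → ℝ) := {ξ | ξ ∈ D ∧ g' ξ = 0} with hE
  have hEdef : (univ : Set ℝ).Definable L E := by
    have h₁ := hL.definable_setOf_mem_and_nonneg (hgraph g' hg'U)
    have h₂ := hL.definable_setOf_mem_and_nonneg (g := fun x => -g' x)
      (hgraph (fun x => -g' x) hg'U.neg)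
    have key : E = {ξ | ξ ∈ D ∧ 0 ≤ g' ξ} ∩ {ξ | ξ ∈ D ∧ 0 ≤ -g' ξ} := by
      ext ξ
      simp only [hE, mem_setOf_eq, mem_inter_iff]
      constructor
      · rintro ⟨hD, h0⟩
        exact ⟨⟨hD, h0.symm.le⟩, ⟨hD, by rw [h0, neg_zero]⟩⟩
      · rintro ⟨⟨hD, h1⟩, ⟨-, h2⟩⟩
        exact ⟨hD, le_antisymm (by linarith) h1⟩
    rw [key]
    exact h₁.inter h₂
  -- `q` transported
  set q' : Fin 2 → ℝ := T q with hq'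
  have hTq' : T.symm q' = q := T.symm_apply_apply q
  have hq'C : q' ∈ C := ⟨q, Metric.mem_closedBall_self (by linarith), rfl⟩
  have hq'E : q' ∈ E := ⟨hCD hq'C, by simp [hg', hTq', hgq]⟩
  -- `E` has empty interior (identity principle), hence dimension `≤ 1`
  have hdimE : dim L 2 E ≤ 1 := by
    by_contra hcon
    have h2 : dim L 2 E = 2 := le_antisymm (dim_le E) (by omega)
    obtain ⟨x₀, hx₀⟩ := interior_nonempty_of_dim_eq hO hlt hEdef ⟨q', hq'E⟩ h2
    -- an open set `W ⊆ E` around `x₀`; its image under `T.symm` is open in the ball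
    rw [mem_interior] at hx₀
    obtain ⟨W, hWE, hWo, hx₀W⟩ := hx₀
    have hy₀ : T.symm x₀ ∈ Metric.ball q r₀ := hDU (hWE hx₀W).1
    have hzero : g =ᶠ[𝓝 (T.symm x₀)] 0 := by
      have hWo' : IsOpen (T.symm '' W) := by
        rw [T.image_symm_eq_preimage]
        exact hWo.preimage T.continuous
      have hmem : T.symm x₀ ∈ T.symm '' W := ⟨x₀, hx₀W, rfl⟩
      filter_upwards [hWo'.mem_nhds hmem] with y hy
      obtain ⟨x, hx, rfl⟩ := hy
      exact (hWE hx).2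
    have hall := hgball.eqOn_zero_of_preconnected_of_eventuallyEq_zero
      (convex_ball q r₀).isPreconnected hy₀ hzero
    have hev : ∀ᶠ y in 𝓝 q, g y = 0 := by
      filter_upwards [Metric.isOpen_ball.mem_nhds (Metric.mem_ball_self hr₀)] with y hy
      exact hall hy
    exact hfreq (hev.mono fun y hy => by simp [hy])
  -- the branches of `E` at `q'`, and the elementary tail
  obtain ⟨b, hb, m, γ, hγc, hγE, hγinj, hγcov⟩ :=
    PlanarConic.exists_branches_of_dim_le_one hL hO hEdef hdimE q'
  have hEg : ∀ x' ∈ E, g (T.symm x') = 0 := fun x' hx' => hx'.2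
  have hgE : ∀ x, g x = 0 → dist x q ≤ r₀ / 2 → T x ∈ E := by
    intro x hgx hxq
    refine ⟨hCD ⟨x, Metric.mem_closedBall.2 hxq, rfl⟩, ?_⟩
    show g (T.symm (T x)) = 0
    rw [T.symm_apply_apply]
    exact hgx
  exact conic_of_curves g q hgq (by linarith : (0 : ℝ) < r₀ / 2) hb E hEg hgE γ hγc hγE hγinj hγcov

/-- **The planar real-analytic conic structure from the o-minimality of `ℝ_an,exp`** (the tree's
named fact `VandendriesMiller1994_realAnExp_isOMinimal`; `ℝ_an,exp` expands the real field,
`realAnExp_isRealFieldExpansion`, and defines every restricted analytic function,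
`realAnExp_definableFun_restrict`).  So the fact `realAnalytic_planarZeroSet_conicStructure` is no
new leaf of the tree: `(h : realAnalytic_planarZeroSet_conicStructure)` may be fed this theorem.
[cite: Dries1998, Ch. 9 (2.3) pp. 149–150] [cite: VandendriesMiller1994, Introduction] -/
theorem realAnalytic_planarZeroSet_conicStructure_of_realAnExp_isOMinimal
    (h : VandendriesMiller1994_realAnExp_isOMinimal) : realAnalytic_planarZeroSet_conicStructure :=
  realAnalytic_planarZeroSet_conicStructure_of_isOMinimal_expansion Language.realAnExp
    realAnExp_isRealFieldExpansion realAnExp_definableFun_restrict h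

end Literature.Analysis.Calculus

end
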